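import Mathlib
import HarnessLib
import Summits.Ventures.LatticeQCDFlow.Scoring.DoeblinPowerBatchMeansCLT
import Summits.Ventures.LatticeQCDFlow.Exactness.CabibboMarinariLatticeErgodic

/-!
# THE `SU(N)` CABIBBO–MARINARI HEAT-BATH SWEEP (the production pure-gauge update): CLT for time
# averages, consistent batch-means error bars and asymptotically exact coverage, from ANY start, for
# every bounded observable — and the Wilson-action instance

HONEST FRAMING: exact (Metropolis-corrected) sampling algorithms for lattice gauge theory;
figures of merit are autocorrelation/cost numbers at stated couplings and volumes; no
continuum-physics claim.

Venture `LatticeQCDFlow` (cell pub-lqcd), topic `Scoring`; FANOUT row 8 (`s0-cpn-nemc`, GEN-20).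
NEW WORK of the cell, not a published result; no definition is introduced; nothing is cited as a
fact.  THE OBJECT IS ROW 9's: the sweep `K = latSweep p frames links` of Cabibbo–Marinari `SU(2)`-subgroup
heat-bath hits over the links of `SU(N)^{links}` (`Exactness/CabibboMarinariLatticeErgodic.lean`), for a
measurable joint density `0 < m ≤ p ≤ M < ∞` against product Haar, frames through all coordinate
pairs, every link visited.  Row 9 proved the ONE-STEP minorisation `K(ω, ·) ≥ ε · Haar^{⊗links}`
(`latSweep_minorised`), the invariance of `π = piGibbsLaw Haar^{⊗} p` (`latSweep_invariant_piGibbsLaw`)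
and uniform ergodicity.  This file adds the error-bar theory of the run `f(X_0), f(X_1), …` for every
bounded measurable `f` and EVERY initial law, through the row's Doeblin-power chain at `m = 1`
(`nHit K 1 = K`): the CLT `(√N')⁻¹ Σ_{t<N'} (f(X_t) − πf) ⇒ N(0, σ²_f)`, the consistency in
probability of the batch-means estimator `a b · SE²_BM → σ²_f`, and the asymptotically exact coverage
of `f̄ ± z σ̂_BM/√N'` when `σ²_f > 0`; then the Wilson action `S = β S_W` on the torus
(`π = wilsonMeasure ρ β`, `Exactness.wilsonMeasure_eq_piGibbsLaw`).

## Content (`n` the colour index type, nonempty, linearly ordered; links `ι` finite; `p` measurable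
## with `m ≤ p ≤ M`, `m ≠ 0`, `M ≠ ∞`; `frames` through all coordinate pairs; `links` containing every link)

* `latSweep_certificate` — `π` invariant and `ε • Haar^{⊗} ≤ (nHit K 1)(ω, ·)` for all `ω`, `0 < ε ≤ 1`;
* **`latSweep_timeAverage_clt`**, **`latSweep_batchMeans_tendstoInMeasure`**,
  **`latSweep_batchMeans_coverage`**;
* Wilson action, gauge group `SU(N)`: **`wilson_cmSweep_batchMeans_tendstoInMeasure`**,
  **`wilson_cmSweep_batchMeans_coverage`**.

NOT CLAIMED: any rate or constant; `σ²_f > 0` (assumed where stated); over-relaxation interleaving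
(row 9's `CabibboMarinariORSweep.lean` composite is covered by `Scoring/DoeblinPowerBatchMeans.lean`
once its certificate is supplied; not instantiated here); floating point.
-/

noncomputable section

namespace Summit.Ventures.LatticeQCDFlow.Scoring

open MeasureTheory ProbabilityTheory Filter Finset Preorder Literature.Probability.MarkovChains
open Literature.MathematicalPhysics.QuantumFieldTheory
open Summit.Ventures.LatticeQCDFlow.Exactness
open scoped ENNReal Topology

section Sweep

variable {n : Type*} [Fintype n] [DecidableEq n] [Nonempty n] [LinearOrder n]
  {ι : Type*} [Fintype ι] [DecidableEq ι] {m : Type*} [Fintype m] [DecidableEq m]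
  {p : Cfg ι n → ℝ≥0∞} {mlo Mhi : ℝ≥0∞}

/-- **The certificate of the Cabibbo–Marinari sweep**, packaged for the row's `…_of_nHit` theorems
(power `1`): `π = piGibbsLaw Haar^{⊗} p` is invariant and `ε • Haar^{⊗} ≤ (nHit K 1)(ω, ·)` for every
`ω`, with `0 < ε ≤ 1`. -/
theorem latSweep_certificate (hp : Measurable p) (hm0 : mlo ≠ 0) (hMtop : Mhi ≠ ∞)
    (hmp : ∀ ω, mlo ≤ p ω) (hpM : ∀ ω, p ω ≤ Mhi) (frames : List (n ≃ Fin 2 ⊕ m))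
    (hlex : frames.map pairOf = lexPairs (Finset.univ.sort (· ≤ ·) : List n) ∨
      frames.map pairOf = (lexPairs (Finset.univ.sort (· ≤ ·) : List n)).reverse)
    {links : List ι} (hl : ∀ l, l ∈ links) :
    Kernel.Invariant (latSweep p frames links) (piGibbsLaw (linkHaar ι n) p) ∧
      ∃ ε : ℝ≥0∞, 0 < ε ∧ ε ≤ 1 ∧ ∀ ω : Cfg ι n,
        ε • Measure.pi (linkHaar ι n) ≤ nHit (latSweep p frames links) 1 ω := by
  obtain ⟨ε, hε, hmin⟩ := latSweep_minorised hp hm0 hMtop hmp hpM frames hlex hl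
  haveI := isMarkovKernel_latSweep hp hm0 hMtop hmp hpM frames links
  have hε1 : ε ≤ 1 := by
    have h1 := Measure.le_iff'.1 (hmin 1) Set.univ
    rwa [Measure.smul_apply, smul_eq_mul, measure_univ, measure_univ, mul_one] at h1
  refine ⟨latSweep_invariant_piGibbsLaw hp hm0 hMtop hmp hpM frames links, ε, pos_iff_ne_zero.2 hε,
    hε1, fun ω => ?_⟩
  rw [GeneralNCMC.nHit_one]
  exact hmin ω

/-- **THE CLT FOR TIME AVERAGES OF THE CABIBBO–MARINARI SWEEP, FROM EVERY INITIAL LAW**: for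
`|f| ≤ C` measurable and `Y ~ N(0, σ²_f)`: `(√N')⁻¹ Σ_{t<N'} (f(X_t) − πf) ⇒ Y` under `P_{μ₀}`. -/
theorem latSweep_timeAverage_clt (hp : Measurable p) (hm0 : mlo ≠ 0) (hMtop : Mhi ≠ ∞)
    (hmp : ∀ ω, mlo ≤ p ω) (hpM : ∀ ω, p ω ≤ Mhi) (frames : List (n ≃ Fin 2 ⊕ m))
    (hlex : frames.map pairOf = lexPairs (Finset.univ.sort (· ≤ ·) : List n) ∨
      frames.map pairOf = (lexPairs (Finset.univ.sort (· ≤ ·) : List n)).reverse)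
    {links : List ι} (hl : ∀ l, l ∈ links) {f : Cfg ι n → ℝ} (hf : Measurable f) {C : ℝ}
    (hC : ∀ ω, |f ω| ≤ C) (μ₀ : Measure (Cfg ι n)) [IsProbabilityMeasure μ₀]
    {Ω' : Type*} [MeasurableSpace Ω'] {P' : Measure Ω'} [IsProbabilityMeasure P'] {Y : Ω' → ℝ}
    (hY : HasLaw Y (gaussianReal 0 (Real.toNNReal
      ((∫ y, (f y - ∫ z, f z ∂(piGibbsLaw (linkHaar ι n) p)) ^ 2 ∂(piGibbsLaw (linkHaar ι n) p))
        + 2 * ∑' j, ∫ y, (f y - ∫ z, f z ∂(piGibbsLaw (linkHaar ι n) p))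
          * (kop (latSweep p frames links))^[j + 1]
            (fun y => f y - ∫ z, f z ∂(piGibbsLaw (linkHaar ι n) p)) y ∂(piGibbsLaw (linkHaar ι n) p)))) P')
    [hK : IsMarkovKernel (latSweep p frames links)]
    [IsProbabilityMeasure (Kernel.trajMeasure (X := fun _ : ℕ => Cfg ι n) μ₀
        (fun t : ℕ => (latSweep p frames links).comap
          (fun h : (i : ↥(Finset.Iic t)) → Cfg ι n => h ⟨t, Finset.mem_Iic.2 le_rfl⟩)
          (measurable_pi_apply _)))] :
    TendstoInDistribution (fun (N' : ℕ) (x : ℕ → Cfg ι n) =>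
        (Real.sqrt N')⁻¹ * ∑ t ∈ Finset.range N', (f (x t) - ∫ z, f z ∂(piGibbsLaw (linkHaar ι n) p)))
      atTop Y (fun _ => (Kernel.trajMeasure (X := fun _ : ℕ => Cfg ι n) μ₀
        (fun t : ℕ => (latSweep p frames links).comap
          (fun h : (i : ↥(Finset.Iic t)) → Cfg ι n => h ⟨t, Finset.mem_Iic.2 le_rfl⟩)
          (measurable_pi_apply _)))) P' := by
  haveI := isProbabilityMeasure_piGibbsLaw (μ := linkHaar ι n) (p := p) hm0 hMtop hmp hpM
  obtain ⟨hπ, ε, hε0, -, hmin⟩ := latSweep_certificate hp hm0 hMtop hmp hpM frames hlex hl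
  exact Exactness.GeneralNCMC.tendstoInDistribution_timeAverage_of_nHit hπ hε0.ne' hmin Nat.one_pos
    hf hC μ₀ hY

/-- **BATCH MEANS ESTIMATE `σ²_f` CONSISTENTLY ALONG THE CABIBBO–MARINARI SWEEP, FROM EVERY INITIAL
LAW**: `a b · SE²_BM → σ²_f` in probability as `a, b → ∞`. -/
theorem latSweep_batchMeans_tendstoInMeasure (hp : Measurable p) (hm0 : mlo ≠ 0) (hMtop : Mhi ≠ ∞)
    (hmp : ∀ ω, mlo ≤ p ω) (hpM : ∀ ω, p ω ≤ Mhi) (frames : List (n ≃ Fin 2 ⊕ m))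
    (hlex : frames.map pairOf = lexPairs (Finset.univ.sort (· ≤ ·) : List n) ∨
      frames.map pairOf = (lexPairs (Finset.univ.sort (· ≤ ·) : List n)).reverse)
    {links : List ι} (hl : ∀ l, l ∈ links) {f : Cfg ι n → ℝ} (hf : Measurable f) {C : ℝ}
    (hC : ∀ ω, |f ω| ≤ C) (μ₀ : Measure (Cfg ι n)) [IsProbabilityMeasure μ₀]
    {a b : ℕ → ℕ} (ha : Tendsto a atTop atTop) (hb : Tendsto b atTop atTop)
    [hK : IsMarkovKernel (latSweep p frames links)] :
    TendstoInMeasure (Kernel.trajMeasure (X := fun _ : ℕ => Cfg ι n) μ₀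
        (fun t : ℕ => (latSweep p frames links).comap
          (fun h : (i : ↥(Finset.Iic t)) → Cfg ι n => h ⟨t, Finset.mem_Iic.2 le_rfl⟩)
          (measurable_pi_apply _)))
      (fun (N' : ℕ) (x : ℕ → Cfg ι n) => ((b N' * a N' : ℕ) : ℝ)
        * replicaSEsq (fun j (x : ℕ → Cfg ι n) =>
            (∑ i ∈ Finset.range (b N'), f (x (b N' * j + i))) / (b N')) (a N') x)
      atTop (fun _ =>
        (∫ y, (f y - ∫ z, f z ∂(piGibbsLaw (linkHaar ι n) p)) ^ 2 ∂(piGibbsLaw (linkHaar ι n) p))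
        + 2 * ∑' j, ∫ y, (f y - ∫ z, f z ∂(piGibbsLaw (linkHaar ι n) p))
          * (kop (latSweep p frames links))^[j + 1]
            (fun y => f y - ∫ z, f z ∂(piGibbsLaw (linkHaar ι n) p)) y ∂(piGibbsLaw (linkHaar ι n) p)) := by
  haveI := isProbabilityMeasure_piGibbsLaw (μ := linkHaar ι n) (p := p) hm0 hMtop hmp hpM
  obtain ⟨hπ, ε, hε0, hε1, hmin⟩ := latSweep_certificate hp hm0 hMtop hmp hpM frames hlex hl
  exact chain_batchMeans_sigmaHat_tendstoInMeasure_of_nHit hπ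
    (Exactness.GeneralNCMC.minorised_setwise hmin) hε0 hε1 Nat.one_pos hf hC μ₀ ha hb

/-- **THE COIN-FREE BATCH-MEANS INTERVAL OF A CABIBBO–MARINARI RUN IS ASYMPTOTICALLY EXACT**
(`σ²_f > 0`, `a, b → ∞`, any initial law, `z > 0`):
`P_{μ₀}(|√N' (f̄_{N'} − πf)| ≤ z σ̂_BM) → (gaussianReal 0 1)[−z, z]`, `N' = b a`. -/
theorem latSweep_batchMeans_coverage (hp : Measurable p) (hm0 : mlo ≠ 0) (hMtop : Mhi ≠ ∞)
    (hmp : ∀ ω, mlo ≤ p ω) (hpM : ∀ ω, p ω ≤ Mhi) (frames : List (n ≃ Fin 2 ⊕ m))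
    (hlex : frames.map pairOf = lexPairs (Finset.univ.sort (· ≤ ·) : List n) ∨
      frames.map pairOf = (lexPairs (Finset.univ.sort (· ≤ ·) : List n)).reverse)
    {links : List ι} (hl : ∀ l, l ∈ links) {f : Cfg ι n → ℝ} (hf : Measurable f) {C : ℝ}
    (hC : ∀ ω, |f ω| ≤ C)
    (hσ : 0 < (∫ y, (f y - ∫ z, f z ∂(piGibbsLaw (linkHaar ι n) p)) ^ 2 ∂(piGibbsLaw (linkHaar ι n) p))
        + 2 * ∑' j, ∫ y, (f y - ∫ z, f z ∂(piGibbsLaw (linkHaar ι n) p))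
          * (kop (latSweep p frames links))^[j + 1]
            (fun y => f y - ∫ z, f z ∂(piGibbsLaw (linkHaar ι n) p)) y ∂(piGibbsLaw (linkHaar ι n) p))
    (μ₀ : Measure (Cfg ι n)) [IsProbabilityMeasure μ₀]
    {a b : ℕ → ℕ} (ha : Tendsto a atTop atTop) (hb : Tendsto b atTop atTop) {z : ℝ} (hz : 0 < z)
    [hK : IsMarkovKernel (latSweep p frames links)] :
    Tendsto (fun N' : ℕ => (Kernel.trajMeasure (X := fun _ : ℕ => Cfg ι n) μ₀
        (fun t : ℕ => (latSweep p frames links).comap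
          (fun h : (i : ↥(Finset.Iic t)) → Cfg ι n => h ⟨t, Finset.mem_Iic.2 le_rfl⟩)
          (measurable_pi_apply _))).real
      {x | |((Real.sqrt ((b N' * a N' : ℕ) : ℝ))⁻¹
          * ∑ t ∈ Finset.range (b N' * a N'), (f (x t) - ∫ z, f z ∂(piGibbsLaw (linkHaar ι n) p)))
        / Real.sqrt (((b N' * a N' : ℕ) : ℝ)
          * replicaSEsq (fun j (x : ℕ → Cfg ι n) =>
              (∑ i ∈ Finset.range (b N'), f (x (b N' * j + i))) / (b N')) (a N') x)| ≤ z})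
      atTop (𝓝 ((gaussianReal 0 1).real (Set.Icc (-z) z))) := by
  haveI := isProbabilityMeasure_piGibbsLaw (μ := linkHaar ι n) (p := p) hm0 hMtop hmp hpM
  obtain ⟨hπ, ε, hε0, hε1, hmin⟩ := latSweep_certificate hp hm0 hMtop hmp hpM frames hlex hl
  exact doeblinPower_batchMeans_studentized_coverage hπ hmin hε0 hε1 Nat.one_pos hf hC hσ μ₀ ha hb hz

end Sweep

/-! ## The Wilson action with gauge group `SU(N)` on the torus -/

section Wilson

variable {n : Type*} [Fintype n] [DecidableEq n] [Nonempty n] [LinearOrder n]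
  {d L N : ℕ} {m : Type*} [Fintype m] [DecidableEq m]
  (ρ : Matrix.specialUnitaryGroup n ℂ →* Matrix (Fin N) (Fin N) ℂ)

omit [Nonempty n] [LinearOrder n] in
/-- The Wilson density `e^{−β S_W}` is measurable and pinched on the compact configuration space
(continuous `ρ`): the hypotheses of the generic theorems, discharged. -/
theorem wilson_gibbsDensity_pinched [NeZero L] (hρ : Continuous ρ) (β : ℝ) :
    ∃ mlo Mhi : ℝ≥0∞, mlo ≠ 0 ∧ Mhi ≠ ∞ ∧
      Measurable (gibbsDensity fun U : GaugeConfig d L (Matrix.specialUnitaryGroup n ℂ) =>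
        β * wilsonAction ρ U) ∧
      (∀ U, mlo ≤ gibbsDensity (fun U : GaugeConfig d L (Matrix.specialUnitaryGroup n ℂ) =>
        β * wilsonAction ρ U) U) ∧
      ∀ U, gibbsDensity (fun U : GaugeConfig d L (Matrix.specialUnitaryGroup n ℂ) =>
        β * wilsonAction ρ U) U ≤ Mhi := by
  have hS := continuous_smul_wilsonAction (d := d) (L := L) ρ hρ β
  obtain ⟨ωa, -, hmin⟩ := isCompact_univ.exists_isMinOn
    (Set.univ_nonempty (α := GaugeConfig d L (Matrix.specialUnitaryGroup n ℂ))) hS.continuousOn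
  obtain ⟨ωb, -, hmax⟩ := isCompact_univ.exists_isMaxOn
    (Set.univ_nonempty (α := GaugeConfig d L (Matrix.specialUnitaryGroup n ℂ))) hS.continuousOn
  have hωa : ∀ ω, β * wilsonAction ρ ωa ≤ β * wilsonAction ρ ω := fun ω =>
    (isMinOn_iff.1 hmin) ω (Set.mem_univ ω)
  have hωb : ∀ ω, β * wilsonAction ρ ω ≤ β * wilsonAction ρ ωb := fun ω =>
    (isMaxOn_iff.1 hmax) ω (Set.mem_univ ω)
  exact ⟨_, _, by rw [Ne, ENNReal.ofReal_eq_zero, not_le]; exact Real.exp_pos _, ENNReal.ofReal_ne_top,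
    (Real.measurable_exp.comp hS.measurable.neg).ennreal_ofReal,
    fun ω => (gibbsDensity_bounds hωa hωb ω).1, fun ω => (gibbsDensity_bounds hωa hωb ω).2⟩

/-- **THE `SU(N)` HEAT-BATH SWEEP FOR THE WILSON ACTION: BATCH MEANS ARE CONSISTENT FOR `σ²_f`,
FROM EVERY START** (continuous `ρ`, any `β`, frames through all coordinate pairs, every edge visited,
`|f| ≤ C` measurable, `a, b → ∞`). -/
theorem wilson_cmSweep_batchMeans_tendstoInMeasure [NeZero L] (hρ : Continuous ρ) (β : ℝ)
    (frames : List (n ≃ Fin 2 ⊕ m))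
    (hlex : frames.map pairOf = lexPairs (Finset.univ.sort (· ≤ ·) : List n) ∨
      frames.map pairOf = (lexPairs (Finset.univ.sort (· ≤ ·) : List n)).reverse)
    {links : List (Edge d L)} (hl : ∀ e, e ∈ links)
    {f : GaugeConfig d L (Matrix.specialUnitaryGroup n ℂ) → ℝ} (hf : Measurable f) {C : ℝ}
    (hC : ∀ U, |f U| ≤ C) (μ₀ : Measure (GaugeConfig d L (Matrix.specialUnitaryGroup n ℂ)))
    [IsProbabilityMeasure μ₀] {a b : ℕ → ℕ} (ha : Tendsto a atTop atTop) (hb : Tendsto b atTop atTop)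
    [hK : IsMarkovKernel (latSweep (gibbsDensity fun U : GaugeConfig d L (Matrix.specialUnitaryGroup n ℂ) =>
      β * wilsonAction ρ U) frames links)] :
    TendstoInMeasure (Kernel.trajMeasure
        (X := fun _ : ℕ => GaugeConfig d L (Matrix.specialUnitaryGroup n ℂ)) μ₀
        (fun t : ℕ => (latSweep (gibbsDensity fun U : GaugeConfig d L (Matrix.specialUnitaryGroup n ℂ) =>
            β * wilsonAction ρ U) frames links).comap
          (fun h : (i : ↥(Finset.Iic t)) → GaugeConfig d L (Matrix.specialUnitaryGroup n ℂ) =>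
            h ⟨t, Finset.mem_Iic.2 le_rfl⟩) (measurable_pi_apply _)))
      (fun (N' : ℕ) (x : ℕ → GaugeConfig d L (Matrix.specialUnitaryGroup n ℂ)) => ((b N' * a N' : ℕ) : ℝ)
        * replicaSEsq (fun j (x : ℕ → GaugeConfig d L (Matrix.specialUnitaryGroup n ℂ)) =>
            (∑ i ∈ Finset.range (b N'), f (x (b N' * j + i))) / (b N')) (a N') x)
      atTop (fun _ =>
        (∫ y, (f y - ∫ z, f z ∂(wilsonMeasure (d := d) (L := L) ρ β)) ^ 2 ∂(wilsonMeasure (d := d) (L := L) ρ β))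
        + 2 * ∑' j, ∫ y, (f y - ∫ z, f z ∂(wilsonMeasure (d := d) (L := L) ρ β))
          * (kop (latSweep (gibbsDensity fun U : GaugeConfig d L (Matrix.specialUnitaryGroup n ℂ) =>
              β * wilsonAction ρ U) frames links))^[j + 1]
            (fun y => f y - ∫ z, f z ∂(wilsonMeasure (d := d) (L := L) ρ β)) y
          ∂(wilsonMeasure (d := d) (L := L) ρ β)) := by
  obtain ⟨mlo, Mhi, hm0, hMtop, hp, hmp, hpM⟩ := wilson_gibbsDensity_pinched (d := d) (L := L) ρ hρ β
  rw [Exactness.wilsonMeasure_eq_piGibbsLaw]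
  exact latSweep_batchMeans_tendstoInMeasure hp hm0 hMtop hmp hpM frames hlex hl hf hC μ₀ ha hb

/-- **THE `SU(N)` HEAT-BATH SWEEP FOR THE WILSON ACTION: THE BATCH-MEANS INTERVAL IS ASYMPTOTICALLY
EXACT** (`σ²_f > 0`, `z > 0`, any start): `P_{μ₀}(|√N' (f̄_{N'} − ⟨f⟩_β)| ≤ z σ̂_BM) → (gaussianReal 0 1)[−z, z]`. -/
theorem wilson_cmSweep_batchMeans_coverage [NeZero L] (hρ : Continuous ρ) (β : ℝ)
    (frames : List (n ≃ Fin 2 ⊕ m))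
    (hlex : frames.map pairOf = lexPairs (Finset.univ.sort (· ≤ ·) : List n) ∨
      frames.map pairOf = (lexPairs (Finset.univ.sort (· ≤ ·) : List n)).reverse)
    {links : List (Edge d L)} (hl : ∀ e, e ∈ links)
    {f : GaugeConfig d L (Matrix.specialUnitaryGroup n ℂ) → ℝ} (hf : Measurable f) {C : ℝ}
    (hC : ∀ U, |f U| ≤ C)
    (hσ : 0 < (∫ y, (f y - ∫ z, f z ∂(wilsonMeasure (d := d) (L := L) ρ β)) ^ 2
          ∂(wilsonMeasure (d := d) (L := L) ρ β))
        + 2 * ∑' j, ∫ y, (f y - ∫ z, f z ∂(wilsonMeasure (d := d) (L := L) ρ β))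
          * (kop (latSweep (gibbsDensity fun U : GaugeConfig d L (Matrix.specialUnitaryGroup n ℂ) =>
              β * wilsonAction ρ U) frames links))^[j + 1]
            (fun y => f y - ∫ z, f z ∂(wilsonMeasure (d := d) (L := L) ρ β)) y
          ∂(wilsonMeasure (d := d) (L := L) ρ β))
    (μ₀ : Measure (GaugeConfig d L (Matrix.specialUnitaryGroup n ℂ))) [IsProbabilityMeasure μ₀]
    {a b : ℕ → ℕ} (ha : Tendsto a atTop atTop) (hb : Tendsto b atTop atTop) {z : ℝ} (hz : 0 < z)
    [hK : IsMarkovKernel (latSweep (gibbsDensity fun U : GaugeConfig d L (Matrix.specialUnitaryGroup n ℂ) =>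
      β * wilsonAction ρ U) frames links)] :
    Tendsto (fun N' : ℕ => (Kernel.trajMeasure
        (X := fun _ : ℕ => GaugeConfig d L (Matrix.specialUnitaryGroup n ℂ)) μ₀
        (fun t : ℕ => (latSweep (gibbsDensity fun U : GaugeConfig d L (Matrix.specialUnitaryGroup n ℂ) =>
            β * wilsonAction ρ U) frames links).comap
          (fun h : (i : ↥(Finset.Iic t)) → GaugeConfig d L (Matrix.specialUnitaryGroup n ℂ) =>
            h ⟨t, Finset.mem_Iic.2 le_rfl⟩) (measurable_pi_apply _))).real
      {x | |((Real.sqrt ((b N' * a N' : ℕ) : ℝ))⁻¹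
          * ∑ t ∈ Finset.range (b N' * a N'),
            (f (x t) - ∫ z, f z ∂(wilsonMeasure (d := d) (L := L) ρ β)))
        / Real.sqrt (((b N' * a N' : ℕ) : ℝ)
          * replicaSEsq (fun j (x : ℕ → GaugeConfig d L (Matrix.specialUnitaryGroup n ℂ)) =>
              (∑ i ∈ Finset.range (b N'), f (x (b N' * j + i))) / (b N')) (a N') x)| ≤ z})
      atTop (𝓝 ((gaussianReal 0 1).real (Set.Icc (-z) z))) := by
  obtain ⟨mlo, Mhi, hm0, hMtop, hp, hmp, hpM⟩ := wilson_gibbsDensity_pinched (d := d) (L := L) ρ hρ β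
  rw [Exactness.wilsonMeasure_eq_piGibbsLaw] at hσ ⊢
  exact latSweep_batchMeans_coverage hp hm0 hMtop hmp hpM frames hlex hl hf hC hσ μ₀ ha hb hz

end Wilson

end Summit.Ventures.LatticeQCDFlow.Scoring

end
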